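import Mathlib
import Literature.NumberTheory.Transcendental.KZLogCalculusProofs
import Literature.NumberTheory.Transcendental.KZSemialgebraicComplex
import Literature.NumberTheory.Transcendental.SemialgebraicLineDeriv
import Summits.KontsevichZagierPeriods.KontsevichZagierPeriods.Theorems.HermiteRigidityGenusTwoCycleTransferPushforwardDimOne

/-!
# `CMTwistQuasiPeriodTransfer` (stmt-KontsevichZagierPeriods-3416, route HermiteRigidity):
# one-dimensional instances of the Kontsevich–Zagier moves

Helper file (lands `--supports stmt-KontsevichZagierPeriods-3416`). Generic one-dimensional
packagings of the moves of the Kontsevich–Zagier calculus (`KZCalculus.lean`) used by the CM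
transfer chains on `y² = 4x³ − 120x + 224`:

* `isSemialgebraic_setOf_apply_lt/gt_of_isAlgebraic` — half-spaces `{x_i < c}`, `{c < x_i}` of
  `ℝⁿ` with a real-algebraic bound `c` are `ℚ`-semialgebraic
  (Kontsevich–Zagier allow algebraic parameters; graph elimination with the `ℚ`-definable
  constants of `isSemialgebraicFunOn_const_of_isAlgebraic`);
* `of_sub_of_mem_changeOfVariablesRel_dimOne` — rule (2) along a real function `φ` of one
  variable: `[σ, (g ∘ φ)·|φ′|] − [φ σ, g]` is ONE change-of-variables move;
* `of_sub_of_sub_mem_relations_split` — rule (1a) at an algebraic abscissa `c`: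
  `[σ, g] − [σ ∩ {x < c}, g] − [σ ∩ {c < x}, g] ∈ relations` (two domain-additivity moves, the
  slice `σ ∩ {x = c}` being Lebesgue-null);
* `of_mem_relations_of_hasDerivAt` — rule (3) over a bounded interval `(u, v)` with algebraic
  endpoints: if the integrand of `r = [(u, v), h]` is the derivative of a function `F` which is
  `ℚ`-semialgebraic on `(u, v)`, continuous on `[u, v]` and vanishes at both endpoints, then
  `[r] ∈ relations` (one Newton–Leibniz move with base `ℝ⁰` and band `[u, v]`, one
  domain-additivity move discarding the two null endpoints, and the value-`0` base constant;
  this is `stub_exactForm` of `HermiteRigidityRealEllipticSectorKernelStubExactForm.lean` with the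
  Hermite primitive `Q√g` replaced by an arbitrary primitive).

References: M. Kontsevich, D. Zagier, *Periods* (2001), §1.2, rules (1)–(3); J. Bochnak,
M. Coste, M.-F. Roy, *Real Algebraic Geometry* (1998), §2.2.
-/

noncomputable section

open Set MeasureTheory MvPolynomial
open Literature.NumberTheory.Transcendental Literature.ModelTheory.ExponentialFields
open Summit.KontsevichZagierPeriods.HermiteRigidity.GenusTwoCycleTransfer
  (hasFDerivAt_fin_one det_smul_id_fin_one)

namespace Summit.KontsevichZagierPeriods.HermiteRigidity.CMTwistQuasiPeriodTransfer

/-! ### Semialgebraic half-spaces with an algebraic bound -/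

/-- `{p | p i < c} ⊆ ℝⁿ` is `ℚ`-semialgebraic for real-algebraic `c`. [cite: KontsevichZagier2001, §1.1] -/
theorem isSemialgebraic_setOf_apply_lt_of_isAlgebraic {n : ℕ} {c : ℝ} (hc : IsAlgebraic ℚ c)
    (i : Fin n) : IsSemialgebraic ℚ {p : Fin n → ℝ | p i < c} := by
  have h1 : IsSemialgebraicFunOn ℚ (univ : Set (Fin n → ℝ)) (fun p => p i - c) :=
    ((isSemialgebraicFunOn_aeval isSemialgebraic_univ (X i : MvPolynomial (Fin n) ℚ)).congr
      (fun p _ => by simp)).fun_sub (isSemialgebraicFunOn_const_of_isAlgebraic isSemialgebraic_univ hc)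
  convert h1.isSemialgebraic_sep_neg using 1
  ext p
  simp [sub_neg]

/-- `{p | c < p i} ⊆ ℝⁿ` is `ℚ`-semialgebraic for real-algebraic `c`. [cite: KontsevichZagier2001, §1.1] -/
theorem isSemialgebraic_setOf_apply_gt_of_isAlgebraic {n : ℕ} {c : ℝ} (hc : IsAlgebraic ℚ c)
    (i : Fin n) : IsSemialgebraic ℚ {p : Fin n → ℝ | c < p i} := by
  have h1 : IsSemialgebraicFunOn ℚ (univ : Set (Fin n → ℝ)) (fun p => c - p i) :=
    (isSemialgebraicFunOn_const_of_isAlgebraic isSemialgebraic_univ hc).fun_sub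
      ((isSemialgebraicFunOn_aeval isSemialgebraic_univ (X i : MvPolynomial (Fin n) ℚ)).congr
        (fun p _ => by simp))
  convert h1.isSemialgebraic_sep_neg using 1
  ext p
  simp [sub_neg]

/-- Images in `ℝ¹` of cylinders over subsets of `ℝ`: if `φ '' S = T` then
`(p ↦ (φ (p 0))) '' {p | p 0 ∈ S} = {q | q 0 ∈ T}`. [folklore] -/
theorem image_fin_one {S T : Set ℝ} {φ : ℝ → ℝ} (h : φ '' S = T) :
    (fun p : Fin 1 → ℝ => fun _ : Fin 1 => φ (p 0)) '' {p | p 0 ∈ S} = {q | q 0 ∈ T} := by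
  ext q
  constructor
  · rintro ⟨p, hp, rfl⟩
    exact h ▸ ⟨p 0, hp, rfl⟩
  · intro hq
    obtain ⟨x, hx, hxq⟩ := (h.symm ▸ hq : q 0 ∈ φ '' S)
    refine ⟨fun _ => x, hx, ?_⟩
    funext i
    rw [Fin.fin_one_eq_zero i, ← hxq]

/-! ### Rule (2) in dimension one -/

/-- **Rule (2) along a function of one variable.** Let `r, r'` be representations in dimension
`1`, `φ` a real function which on `r.domain` is `ℚ`-semialgebraic, differentiable with derivative
`φ'` and injective, with `r'.domain = φ(r.domain)` and `r.integrand = (r'.integrand ∘ φ)·|φ'|` on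
`r.domain`. Then `[r] − [r']` is ONE change-of-variables move (`KZ.changeOfVariablesRel`) for the
map `Φ : p ↦ (φ (p 0))` of `ℝ¹`, whose derivative `φ'(p 0) • id` has determinant `φ'(p 0)`.
[cite: KontsevichZagier2001, §1.2 rule (2)] -/
theorem of_sub_of_mem_changeOfVariablesRel_dimOne (r r' : KZ.IntegralRep 1) (φ φ' : ℝ → ℝ)
    (hφ : IsSemialgebraicFunOn ℚ r.domain (fun p => φ (p 0)))
    (hder : ∀ p ∈ r.domain, HasDerivAt φ (φ' (p 0)) (p 0))
    (hinj : ∀ p ∈ r.domain, ∀ q ∈ r.domain, φ (p 0) = φ (q 0) → p 0 = q 0)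
    (hdom : r'.domain = (fun p : Fin 1 → ℝ => fun _ : Fin 1 => φ (p 0)) '' r.domain)
    (hw : ∀ p ∈ r.domain, r.integrand p = r'.integrand (fun _ => φ (p 0)) * |φ' (p 0)|) :
    KZ.of r - KZ.of r' ∈ KZ.changeOfVariablesRel := by
  set Φ : (Fin 1 → ℝ) → (Fin 1 → ℝ) := fun p _ => φ (p 0) with hΦ_def
  set Φ' : (Fin 1 → ℝ) → ((Fin 1 → ℝ) →L[ℝ] (Fin 1 → ℝ)) :=
    fun p => φ' (p 0) • ContinuousLinearMap.id ℝ (Fin 1 → ℝ) with hΦ'_def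
  have hΦsa : IsSemialgebraicMapOn ℚ r.domain Φ :=
    IsSemialgebraicMapOn.of_forall r.isSemialgebraic_domain fun _ => hφ
  have hinjΦ : InjOn Φ r.domain := by
    intro p hp q hq h
    have h0 := hinj p hp q hq (congrFun h 0)
    funext i
    rw [Fin.fin_one_eq_zero i]
    exact h0
  have hderiv : ∀ p ∈ r.domain, HasFDerivWithinAt Φ (Φ' p) r.domain p := fun p hp =>
    (hasFDerivAt_fin_one φ (φ' (p 0)) p (hder p hp)).hasFDerivWithinAt
  have hdet : ∀ p, (Φ' p).det = φ' (p 0) := fun p => det_smul_id_fin_one (φ' (p 0))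
  refine ⟨1, r, r', Φ, Φ', hΦsa, hderiv, hinjΦ, hdom, fun p hp => ?_, rfl⟩
  rw [hdet, hw p hp]

/-! ### Rule (1a): splitting an interval representation at an algebraic abscissa -/

/-- **Splitting at an algebraic point.** If `r₁`, `r₂` carry the integrand of `r` on
`r.domain ∩ {x < c}` and `r.domain ∩ {c < x}` (`c` real algebraic), then
`[r] − [r₁] − [r₂] ∈ KZ.relations`: two domain-additivity moves, the middle slice
`r.domain ∩ {x = c}` lying in the null hyperplane `{x = c}` (a representation over a null domain
is a relation, `KZ.of_mem_relations_of_volume_eq_zero`). [cite: KontsevichZagier2001, §1.2 rule (1)] -/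
theorem of_sub_of_sub_mem_relations_split (r r₁ r₂ : KZ.IntegralRep 1) {c : ℝ}
    (hc : IsAlgebraic ℚ c) (h₁ : r₁.domain = r.domain ∩ {p | p 0 < c})
    (h₂ : r₂.domain = r.domain ∩ {p | c < p 0}) (hi₁ : EqOn r.integrand r₁.integrand r₁.domain)
    (hi₂ : EqOn r.integrand r₂.integrand r₂.domain) :
    KZ.of r - KZ.of r₁ - KZ.of r₂ ∈ KZ.relations := by
  -- the middle slice and the union of the two sides, as restrictions of `r`
  have hmid : IsSemialgebraic ℚ (r.domain ∩ {p | p 0 = c}) :=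
    r.isSemialgebraic_domain.inter (isSemialgebraic_setOf_apply_eq_of_isAlgebraic hc 0)
  have h12 : IsSemialgebraic ℚ (r₁.domain ∪ r₂.domain) :=
    r₁.isSemialgebraic_domain.union r₂.isSemialgebraic_domain
  have hsub12 : r₁.domain ∪ r₂.domain ⊆ r.domain := by
    rw [h₁, h₂]
    exact union_subset inter_subset_left inter_subset_left
  set rm := r.restrict (r.domain ∩ {p | p 0 = c}) hmid inter_subset_left with hrm
  set r₁₂ := r.restrict (r₁.domain ∪ r₂.domain) h12 hsub12 with hr₁₂
  have hnull : volume (r.domain ∩ {p : Fin 1 → ℝ | p 0 = c}) = 0 :=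
    measure_mono_null inter_subset_right (KZ.volume_setOf_last_eq_zero (n := 0) c)
  -- first domain-additivity move: `r = r₁₂ ∪ rm`
  have hD1 : KZ.of r - KZ.of r₁₂ - KZ.of rm ∈ KZ.domainAddRel := by
    refine ⟨1, r, r₁₂, rm, ?_, ?_, fun _ _ => rfl, fun _ _ => rfl, rfl⟩
    · simp only [hr₁₂, hrm, KZ.IntegralRep.domain_restrict, h₁, h₂]
      ext p
      simp only [mem_union, mem_inter_iff, mem_setOf_eq]
      constructor
      · intro hp
        rcases lt_trichotomy (p 0) c with h | h | h
        · exact Or.inl (Or.inl ⟨hp, h⟩)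
        · exact Or.inr ⟨hp, h⟩
        · exact Or.inl (Or.inr ⟨hp, h⟩)
      · rintro ((⟨hp, -⟩ | ⟨hp, -⟩) | ⟨hp, -⟩) <;> exact hp
    · simp only [hr₁₂, hrm, KZ.IntegralRep.domain_restrict]
      exact measure_mono_null inter_subset_right hnull
  -- second domain-additivity move: `r₁₂ = r₁ ∪ r₂`, disjoint
  have hD2 : KZ.of r₁₂ - KZ.of r₁ - KZ.of r₂ ∈ KZ.domainAddRel := by
    refine ⟨1, r₁₂, r₁, r₂, rfl, ?_, hi₁, hi₂, rfl⟩
    have : r₁.domain ∩ r₂.domain = ∅ := by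
      rw [h₁, h₂]
      ext p
      simp only [mem_inter_iff, mem_setOf_eq, mem_empty_iff_false, iff_false]
      rintro ⟨⟨-, h1⟩, -, h2⟩
      exact lt_asymm h1 h2
    rw [this, measure_empty]
  have hm : KZ.of rm ∈ KZ.relations := KZ.of_mem_relations_of_volume_eq_zero rm hnull
  have : KZ.of r - KZ.of r₁ - KZ.of r₂ = (KZ.of r - KZ.of r₁₂ - KZ.of rm) +
      (KZ.of r₁₂ - KZ.of r₁ - KZ.of r₂) + KZ.of rm := by abel
  rw [this]
  exact KZ.relations.add_mem (KZ.relations.add_mem (KZ.domainAddRel_subset_relations hD1)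
    (KZ.domainAddRel_subset_relations hD2)) hm

/-! ### Rule (3): an exact form over an interval with algebraic endpoints -/

/-- **An exact form integrates to a relation.** Let `r = [(u, v), h]` (`u < v` real algebraic)
and let `F : ℝ → ℝ` be `ℚ`-semialgebraic on `(u, v)` (as a function on `r.domain ⊆ ℝ¹`),
continuous on `[u, v]`, with derivative `h` on `(u, v)` and `F(u) = F(v) = 0`. Then
`[r] ∈ KZ.relations`: ONE Newton–Leibniz move with base `ℝ⁰`, constant bounds `u ≤ v` and CLOSED
band `[u, v] = r.domain ∪ {u, v}` carrying `𝟙_{r.domain}·h` and the primitive `F` (glued with the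
value `0` over the two endpoints), whose base `[ℝ⁰, F(v) − F(u)] = [ℝ⁰, 0]` is a relation; then
ONE domain-additivity move discarding the two (null) endpoints.
[cite: KontsevichZagier2001, §1.2 rules (1), (3)] -/
theorem of_mem_relations_of_hasDerivAt {u v : ℝ} (huv : u < v) (hua : IsAlgebraic ℚ u)
    (hva : IsAlgebraic ℚ v) (F : ℝ → ℝ) (r : KZ.IntegralRep 1)
    (hr : r.domain = {p | u < p 0 ∧ p 0 < v})
    (hF : IsSemialgebraicFunOn ℚ r.domain (fun p => F (p 0)))
    (hFc : ContinuousOn F (Icc u v))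
    (hFd : ∀ p ∈ r.domain, HasDerivAt F (r.integrand p) (p 0))
    (hFu : F u = 0) (hFv : F v = 0) : KZ.of r ∈ KZ.relations := by
  have hsnoc : ∀ (x : Fin 0 → ℝ) (t : ℝ), (Fin.snoc x t : Fin 1 → ℝ) 0 = t := fun _ _ => rfl
  -- the two endpoints `E = {u, v} ⊆ ℝ¹`: semialgebraic, null, disjoint from `r.domain`
  obtain ⟨E, hEdef⟩ : ∃ E : Set (Fin 1 → ℝ), E = {z | z 0 = u ∨ z 0 = v} := ⟨_, rfl⟩
  have hE : IsSemialgebraic ℚ E := by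
    rw [hEdef]
    exact (isSemialgebraic_setOf_apply_eq_of_isAlgebraic hua 0).union
      (isSemialgebraic_setOf_apply_eq_of_isAlgebraic hva 0)
  have hEvol : volume E = 0 := by
    have : E = {fun _ => u, fun _ => v} := by
      rw [hEdef]; ext z; simp [funext_iff, Fin.forall_fin_one]
    rw [this]
    exact (Set.toFinite _).measure_zero _
  have hEr : ∀ z ∈ E, z ∉ r.domain := by
    intro z hz hzr
    rw [hEdef] at hz
    rw [hr, mem_setOf_eq] at hzr
    rcases hz with h | h <;> rw [h] at hzr <;> linarith [hzr.1, hzr.2]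
  have hE0 : ∀ z ∈ E, F (z 0) = 0 := by
    intro z hz
    rw [hEdef] at hz
    rcases hz with h | h
    · rw [h, hFu]
    · rw [h, hFv]
  -- the closed band `[u, v] = r.domain ∪ E` with the integrand `𝟙_{r.domain} r.integrand`
  have hB : IsSemialgebraic ℚ (r.domain ∪ E) := r.isSemialgebraic_domain.union hE
  have hzeroE : IsSemialgebraicFunOn ℚ E (fun _ => (0 : ℝ)) :=
    (isSemialgebraicFunOn_aeval hE (0 : MvPolynomial (Fin 1) ℚ)).congr fun z _ => by simp
  have hBfun : IsSemialgebraicFunOn ℚ (r.domain ∪ E) (indicator r.domain r.integrand) :=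
    IsSemialgebraicFunOn.union r.isSemialgebraicFunOn_integrand hzeroE
      (fun z hz => indicator_of_mem hz _) (fun z hz => indicator_of_notMem (hEr z hz) _)
  have hBint : IntegrableOn (indicator r.domain r.integrand) (r.domain ∪ E) :=
    ((integrable_indicator_iff (KZ.IntegralRep.measurableSet_domain_holds r)).mpr
      r.integrableOn).integrableOn
  obtain ⟨rb, hrbd, hrbi⟩ : ∃ rb : KZ.IntegralRep 1, rb.domain = r.domain ∪ E ∧
      rb.integrand = indicator r.domain r.integrand :=
    ⟨⟨r.domain ∪ E, indicator r.domain r.integrand, hB, hBfun, hBint⟩, rfl, rfl⟩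
  -- the base `[ℝ⁰, 0]`
  obtain ⟨r₀, hr₀d, hr₀i⟩ := KZ.exists_zeroRep (n := 0) (σ := univ) isSemialgebraic_univ
  -- the primitive is semialgebraic on the band (value `0` over the endpoints)
  have hF' : IsSemialgebraicFunOn ℚ (r.domain ∪ E) (fun z => F (z 0)) :=
    IsSemialgebraicFunOn.union hF hzeroE (fun _ _ => rfl) (fun z hz => hE0 z hz)
  -- ONE Newton–Leibniz move
  have hNL : KZ.of rb - KZ.of r₀ ∈ KZ.newtonLeibnizRel := by
    refine ⟨0, rb, r₀, fun _ => u, fun _ => v, fun z => F (z 0), hrbd ▸ hF', ?_, ?_,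
      fun _ _ => huv.le, ?_, ?_, ?_, ?_, rfl⟩
    · rw [hr₀d]; exact isSemialgebraicFunOn_const_of_isAlgebraic isSemialgebraic_univ hua
    · rw [hr₀d]; exact isSemialgebraicFunOn_const_of_isAlgebraic isSemialgebraic_univ hva
    · rw [hrbd, hr₀d, hEdef, hr]
      ext z
      simp only [mem_union, mem_setOf_eq, mem_univ, true_and, Fin.last_zero]
      constructor
      · rintro (⟨h1, h2⟩ | h | h)
        · exact ⟨h1.le, h2.le⟩
        · rw [h]; exact ⟨le_rfl, huv.le⟩
        · rw [h]; exact ⟨huv.le, le_rfl⟩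
      · rintro ⟨h1, h2⟩
        rcases h1.lt_or_eq with h1 | h1
        · rcases h2.lt_or_eq with h2 | h2
          · exact Or.inl ⟨h1, h2⟩
          · exact Or.inr (Or.inr h2)
        · exact Or.inr (Or.inl h1.symm)
    · intro x _
      show ContinuousOn (fun t : ℝ => F ((Fin.snoc x t : Fin 1 → ℝ) 0)) _
      simp only [hsnoc]
      exact hFc
    · intro x _ t ht
      have hmem : (Fin.snoc x t : Fin 1 → ℝ) ∈ r.domain := by
        rw [hr]; exact ht
      show HasDerivAt (fun s : ℝ => F ((Fin.snoc x s : Fin 1 → ℝ) 0)) (rb.integrand (Fin.snoc x t)) t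
      rw [hrbi, indicator_of_mem hmem]
      simp only [hsnoc]
      exact hFd _ hmem
    · intro x _
      simp only [hr₀i, Pi.zero_apply, hsnoc, hFu, hFv, sub_zero]
  -- the band representation is a relation
  have hrb : KZ.of rb ∈ KZ.relations := by
    have h1 := KZ.newtonLeibnizRel_subset_relations hNL
    have h2 : KZ.of r₀ ∈ KZ.relations :=
      KZ.of_mem_relations_of_eqOn_zero r₀ (by rw [hr₀i]; exact fun _ _ => rfl)
    simpa using KZ.relations.add_mem h1 h2
  -- ONE domain-additivity move: band versus open interval, the two endpoints being null
  have hsub : E ⊆ rb.domain := by rw [hrbd]; exact subset_union_right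
  have hre : KZ.of (rb.restrict E hE hsub) ∈ KZ.relations :=
    KZ.of_mem_relations_of_volume_eq_zero _ hEvol
  have hDA : KZ.of rb - KZ.of r - KZ.of (rb.restrict E hE hsub) ∈ KZ.domainAddRel :=
    ⟨1, rb, r, rb.restrict E hE hsub, by rw [KZ.IntegralRep.domain_restrict, hrbd],
      measure_mono_null inter_subset_right hEvol,
      fun z hz => by rw [hrbi]; exact indicator_of_mem hz _, fun _ _ => rfl, rfl⟩
  have h2 : KZ.of r = KZ.of rb - (KZ.of rb - KZ.of r - KZ.of (rb.restrict E hE hsub)) -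
      KZ.of (rb.restrict E hE hsub) := by abel
  rw [h2]
  exact KZ.relations.sub_mem (KZ.relations.sub_mem hrb (KZ.domainAddRel_subset_relations hDA)) hre

end Summit.KontsevichZagierPeriods.HermiteRigidity.CMTwistQuasiPeriodTransfer

end
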